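import Summits.BirchSwinnertonDyer.BirchSwinnertonDyer.Theorems.ClassRecordThreeCornerAtThreeShimuraWalkFamilyDictionary
import Summits.BirchSwinnertonDyer.BirchSwinnertonDyer.Theorems.ErratumRoadFiveShimuraKolyvaginOrderBoundInertCarrierLevelData
import HarnessLib

/-!
# The LEVEL-DATA (presentation) package for a family of GENERALISED Kolyvagin data `d : (m : ℕ) → m ∣ n → JET.KolyvaginFamilyData W K ι m`
# — x11b3's `KolyvaginH44.exists_levelData` RE-KEYED on the family datum (cell `bsd-stepL`, seat `bsd-stepL-corner3-p2` g8 = WIDTH-LEVER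
# lane B; `--supports stmt-BirchSwinnertonDyer-21420 --as helper`; CLAIM 02:43Z)

WHY (plan g39 RULING 47 (4), PORT MAP (P2) §2–§3). The abstract Kolyvagin ENDs of the tree quantify over level data
`(σ_m, H_m, f_m, y_m, π_m, j_m, e_m)` over `𝒢_m = ringClassGal ι m` — `KolyvaginH44.h44_of_prop37_of_dvd` (McCallum Prop. 4.4),
`KolyvaginH37Bridge.h37_of_traceRelation_of_congruence` (Gross 3.7), `GrossBadPlace.kolyvaginClass_kolyvaginPoint_mem_selmerLocalKer_of_GZ31_E0`
(Gross 6.2 (1)), `KolyvaginEuler.conj_kolyvaginPoint_sub_mem` (Gross 5.4), tam3-p1's `…StringentOfOrbitReceptacle` (Jetchev 4.9, p594055) —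
and x11b3 SUPPLIED those data from `KolyvaginHeegnerData` by `KolyvaginH44.exists_levelData`. The (P1)∕(P2) ports of the Shimura road run on
tam3-p1's generalised datum `JET.KolyvaginFamilyData` (no `X₀(N)` fields); THIS FILE is the family twin of `exists_levelData`, proof VERBATIM with
the three datum lemmas replaced by their family forms (`exists_section_of_transversal_image` (shim-p1 K1), `ShimuraWalk.familyData_σ_pow_succ_eq_one`
(p598128), shim-p1's `map_pointGalHom_eq_smul_map`), PLUS the H37-bridge conjunct at the divisors: under the structures of `ShimuraWalk.PDiv`'s body,
`kolyvaginPoint σ_m m.primeFactors f_m y_m = (d m hm).derivedPoint` — so that every consumer reads the datum's `derivedPoint` ∕ `toGeomPoints` ∕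
`kolyvaginClass` directly. Also `exists_familyData_forall_y_eq`: a bare family `ys` over a square-free top level populates data at EVERY divisor
(level by level, `ShimuraWalk.exists_familyData_y_eq`).
HONEST FRAMING: theorems only (no definition, no named fact, no `sorry`); ring-class ∕ coordinate plumbing; nothing about any curve; no stub closes;
BSD is not proved by any of this; T7. Credit: x11b3 (exists_levelData, H37 bridge), shim-p1 g8 (K1), tam3-p1 g12 (datum).
References: [cite: GrossLMS1991, §3 (pp. 216–217: 𝒢_n, G_n, σ_ℓ), §4 (4.1)] [cite: McCallumLMS1991, §4 (4)] [cite: BertoliniDarmon1996, §2.3–2.5].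
presearch: not applicable (re-keying of a tree theorem); `lean search 'exists_levelData_familyData'` → none.
-/

set_option autoImplicit false
set_option linter.dupNamespace false

noncomputable section

open scoped Classical

namespace Summit.BirchSwinnertonDyer.BirchSwinnertonDyer.Theorems.ShimuraWalk

open WeierstrassCurve Field NumberField IsDedekindDomain Finset
  Literature.NumberTheory.EllipticCurves Literature.NumberTheory.GaloisRepresentations
  Literature.NumberTheory.EllipticCurves.KolyvaginCocycle
  Literature.NumberTheory.EllipticCurves.KolyvaginEuler
  Literature.NumberTheory.EllipticCurves.RingClassField
  Summit.BirchSwinnertonDyer.Rank1Residual.X11b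
  Summit.BirchSwinnertonDyer.Rank1Residual.JET
  Summit.BirchSwinnertonDyer.BirchSwinnertonDyer.Theorems

variable {K : Type} [Field K] [NumberField K] {W : WeierstrassCurve ℚ} {ι : K →+* ℂ}

/-- **Data at every divisor from a bare family**: for a square-free `n` with inert prime factors and any `ys : (m : ℕ) → E(K[m])`, there are
`d m hm : KolyvaginFamilyData W K ι m` with `(d m hm).y = ys m` at every `m ∣ n`. [cite: GrossLMS1991, §3 (σ_ℓ), §4 (4.1) (S)] -/
theorem exists_familyData_forall_y_eq (hK : IsImaginaryQuadratic K) (ι : K →+* ℂ) {n : ℕ} (hn : Squarefree n)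
    (hinert : ∀ q ∈ n.primeFactors, (Ideal.span {(q : 𝓞 K)}).IsPrime)
    (ys : (m : ℕ) → (W.baseChange (ringClassField K ι m)).toAffine.Point) :
    ∃ d : (m : ℕ) → m ∣ n → KolyvaginFamilyData W K ι m, ∀ (m : ℕ) (hm : m ∣ n), (d m hm).y = ys m := by
  have h : ∀ m : ℕ, m ∣ n → ∃ dm : KolyvaginFamilyData W K ι m, dm.y = ys m := fun m hm ↦
    exists_familyData_y_eq (W := W) hK ι (hn.squarefree_of_dvd hm)
      (fun q hq ↦ hinert q (Nat.primeFactors_mono hm hn.ne_zero hq)) ys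
  choose d hd using h
  exact ⟨d, hd⟩

/-- **Level data at every `m : ℕ` for a family of generalised Kolyvagin data** — x11b3's `KolyvaginH44.exists_levelData` with
`KolyvaginHeegnerData Dt β ι m` replaced by `JET.KolyvaginFamilyData W K ι m`, SAME shape (so that x11b3's ENDs apply to the family verbatim),
PLUS one conjunct at the divisors: under the structures of `ShimuraWalk.PDiv`'s body, the abstract Kolyvagin point of `(σ_m, f_m, y_m)` IS the datum's
`derivedPoint` (x11b3-p8's H37 bridge). [cite: GrossLMS1991, §3 (pp. 216–217), §4 (4.1)] -/
theorem exists_levelData_familyData (hK : IsImaginaryQuadratic K) (ι : K →+* ℂ) {n : ℕ} (hn : Squarefree n)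
    (hinert : ∀ q ∈ n.primeFactors, (Ideal.span {(q : 𝓞 K)}).IsPrime)
    (d : (m : ℕ) → m ∣ n → KolyvaginFamilyData W K ι m) (m : ℕ) :
    letI : CommGroup (ringClassGal ι m) := { (inferInstance : Group (ringClassGal ι m)) with
      mul_comm := fun a b ↦ (KolyvaginH44.isMulCommutative_ringClassGal' hK ι m).is_comm.comm a b }
    letI : DistribMulAction (ringClassGal ι m) ((W.baseChange (ringClassField K ι m)).toAffine.Point) :=
      DistribMulAction.compHom _ ((pointGalHom W (ringClassField K ι m)).comp (ringClassGal ι m).subtype)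
    ∃ (σ : ℕ → ringClassGal ι m) (H : Subgroup (ringClassGal ι m)) (_ : Fintype (ringClassGal ι m ⧸ H))
      (f : ringClassGal ι m ⧸ H → ringClassGal ι m)
      (y : (W.baseChange (ringClassField K ι m)).toAffine.Point)
      (π : absoluteGaloisGroup K →* ringClassGal ι m)
      (j : (W.baseChange (ringClassField K ι m)).toAffine.Point →+ geomPoints (W.baseChange K))
      (e : ringClassField K ι m →ₐ[K] AlgebraicClosure K),
      (∀ q ∈ m.primeFactors, σ q ^ (q + 1) = 1) ∧
      (∀ (τ : absoluteGaloisGroup K) (P : (W.baseChange (ringClassField K ι m)).toAffine.Point),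
        j (pointGalHom W (ringClassField K ι m)
          (π τ : ringClassField K ι m ≃ₐ[ℚ] ringClassField K ι m) P) = τ • j P) ∧
      (∀ (τ : absoluteGaloisGroup K) (x : ringClassField K ι m),
        τ • e x = e ((π τ : ringClassField K ι m ≃ₐ[ℚ] ringClassField K ι m) x)) ∧
      (∀ c, (f c : ringClassGal ι m ⧸ H) = c) ∧
      (∀ h ∈ H, (h : ringClassField K ι m ≃ₐ[ℚ] ringClassField K ι m) ∈ ringClassGalOver ι m 1) ∧
      (∀ hm : m ∣ n,
        j = (d m hm).toGeomPoints ∧ y = (d m hm).y ∧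
        (∀ q ∈ m.primeFactors,
          (σ q : ringClassField K ι m ≃ₐ[ℚ] ringClassField K ι m) = (d m hm).σ q) ∧
        (∀ c, (f c : ringClassField K ι m ≃ₐ[ℚ] ringClassField K ι m) ∈ (d m hm).S) ∧
        (∀ x, e x = (d m hm).emb x) ∧
        kolyvaginPoint σ m.primeFactors f y = (d m hm).derivedPoint) ∧
      (¬ m ∣ n → j = 0) := by
  letI hcg : CommGroup (ringClassGal ι m) := { (inferInstance : Group (ringClassGal ι m)) with
    mul_comm := fun a b ↦ (KolyvaginH44.isMulCommutative_ringClassGal' hK ι m).is_comm.comm a b }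
  letI act : DistribMulAction (ringClassGal ι m) ((W.baseChange (ringClassField K ι m)).toAffine.Point) :=
    DistribMulAction.compHom _ ((pointGalHom W (ringClassField K ι m)).comp (ringClassGal ι m).subtype)
  haveI : Finite (ringClassGal ι m) := KolyvaginH44.finite_ringClassGal hK ι m
  have hn0 : n ≠ 0 := Squarefree.ne_zero hn
  set ρ : ringClassGal ι m →* (ringClassField K ι m ≃ₐ[ℚ] ringClassField K ι m) := (ringClassGal ι m).subtype with hρ
  have hρi : Function.Injective ρ := (ringClassGal ι m).subtype_injective
  have hsmul : ∀ (g : ringClassGal ι m) (Q : (W.baseChange (ringClassField K ι m)).toAffine.Point),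
      g • Q = pointGalHom W (ringClassField K ι m) (ρ g) Q := fun _ _ ↦ rfl
  by_cases hm : m ∣ n
  · -- a genuine level: the data of `d m hm`
    set dm := d m hm with hdm
    let e : ringClassField K ι m →ₐ[K] AlgebraicClosure K := { dm.emb with commutes' := dm.emb_apply }
    have he : ∀ x, e x = dm.emb x := fun _ ↦ rfl
    obtain ⟨π, hπ⟩ := KolyvaginH44.exists_absGaloisRestrict hK ι m e
    -- the canonical subgroup and a section valued in `dm.S`
    set Hc : Subgroup (ringClassGal ι m) := (ringClassGalOver ι m 1).comap ρ with hHc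
    letI hF : Fintype (ringClassGal ι m ⧸ Hc) := Fintype.ofFinite _
    have hHc' : ∀ h ∈ Hc, ρ h ∈ ringClassGalOver ι m 1 := fun h hh ↦ Subgroup.mem_comap.mp hh
    have hSρ : ((dm.S : Set (ringClassField K ι m ≃ₐ[ℚ] ringClassField K ι m))) ⊆ Set.range ρ :=
      fun s hs ↦ ⟨⟨s, dm.S_subset s hs⟩, rfl⟩
    obtain ⟨f, hf, hfS⟩ := exists_section_comap_of_transversal ι m ρ (fun g ↦ g.2) hSρ dm.S_transversal
    -- generators pulled into `𝒢_m`
    have hσmem : ∀ q ∈ m.primeFactors, dm.σ q ∈ ringClassGal ι m := fun q hq ↦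
      ringClassGalOver_le_ringClassGal ι m (m / q) ((dm.zpowers_σ q hq) ▸ Subgroup.mem_zpowers _)
    let σ : ℕ → ringClassGal ι m := fun q ↦
      if hq : q ∈ m.primeFactors then ⟨dm.σ q, hσmem q hq⟩ else 1
    have hσ : ∀ q ∈ m.primeFactors,
        (σ q : ringClassField K ι m ≃ₐ[ℚ] ringClassField K ι m) = dm.σ q := fun q hq ↦ by
      simp only [σ, dif_pos hq]
    -- the H37 bridge
    have hbij := KolyvaginH37Bridge.bijOn_of_section_of_transversal ρ hρi (H := Hc)
      (Γ := ringClassGal ι m) (G₁ := ringClassGalOver ι m 1) hHc'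
      (S := (↑dm.S : Set (ringClassField K ι m ≃ₐ[ℚ] ringClassField K ι m)))
      (fun s hs ↦ dm.S_subset s hs) hSρ (fun g hg ↦ dm.S_transversal g hg) f hf hfS
    have hbr : kolyvaginPoint σ m.primeFactors f dm.y = dm.derivedPoint := by
      have h := KolyvaginH37Bridge.map_kolyvaginPoint_eq_derivedPoint (pointGalHom W (ringClassField K ι m))
        ρ (AddMonoidHom.id ((W.baseChange (ringClassField K ι m)).toAffine.Point)) (fun g a ↦ hsmul g a)
        (hn.squarefree_of_dvd hm) (τ := dm.σ) hσ f hbij dm.y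
      rw [AddMonoidHom.id_apply, AddMonoidHom.id_apply] at h
      exact h
    refine ⟨σ, Hc, hF, f, dm.y, π, dm.toGeomPoints, e, ?_, ?_, hπ, hf, hHc', fun hm' ↦ ?_, fun h ↦ (h hm).elim⟩
    · intro q hq
      apply Subtype.ext
      rw [SubmonoidClass.coe_pow, hσ q hq, OneMemClass.coe_one]
      exact familyData_σ_pow_succ_eq_one hK dm (hn.squarefree_of_dvd hm) hq
        (hinert q (Nat.primeFactors_mono hm hn0 hq))
    · intro τ P
      exact map_pointGalHom_eq_smul_map W dm.emb (fun x ↦ by rw [← he, ← he]; exact hπ τ x) _ rfl P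
    · have hdd : d m hm' = dm := rfl
      rw [hdd]
      exact ⟨rfl, rfl, hσ, hfS, he, hbr⟩
  · -- a junk level
    obtain ⟨e⟩ := KolyvaginH44.nonempty_algHom_ringClassField hK ι m
    obtain ⟨π, hπ⟩ := KolyvaginH44.exists_absGaloisRestrict hK ι m e
    letI hF : Fintype (ringClassGal ι m ⧸ (ringClassGalOver ι m 1).comap ρ) := Fintype.ofFinite _
    refine ⟨fun _ ↦ 1, (ringClassGalOver ι m 1).comap ρ, hF,
      fun c ↦ c.out, 0, π, 0, e, fun _ _ ↦ one_pow _, fun τ P ↦ ?_, hπ,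
      fun c ↦ QuotientGroup.out_eq' c, fun h hh ↦ Subgroup.mem_comap.mp hh,
      fun hm' ↦ (hm hm').elim, fun _ ↦ rfl⟩
    rw [AddMonoidHom.zero_apply, AddMonoidHom.zero_apply, smul_zero]

end Summit.BirchSwinnertonDyer.BirchSwinnertonDyer.Theorems.ShimuraWalk

end
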